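import Summits.FinalStateConjecture.FinalStateConjecture.Theorems.ClusterCompletenessOmegaLimitMultiKerrT2Defs
import Summits.FinalStateConjecture.FinalStateConjecture.Theorems.ClusterCompletenessOmegaLimitMultiKerrTransport
import Summits.FinalStateConjecture.FinalStateConjecture.Theorems.ZeroEnergyKerrOrBombStationaryLimitReductionOneDevelopment
import Summits.FinalStateConjecture.FinalStateConjecture.Theorems.PhaseMixingCaptureWeakCosmicCensorshipMGHDCompleteNullInfinityInvariant
import Summits.FinalStateConjecture.FinalStateConjecture.Theorems.PhaseMixingCaptureWeakCosmicCensorshipMGHDStubScriTransfer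
import Literature.Geometry.Lorentzian.IsometricImmersionExp
import HarnessLib

-- buildfix 2026-08-20 (import-only): this T2 file used to import its pre-T2 predecessor
-- `…OmegaLimitMultiKerrSingleDevelopment` (statement-level dead since the T2 re-type) although it uses none of its
-- declarations; it now imports that module's three imports directly (`recurs_of_isIsometricTo` is from `…Transport`).

/-!
# Crux `ClusterCompleteness.OmegaLimitMultiKerr` (stmt-FinalStateConjecture-14664), line `Sketch` —
# the SINGLE-DEVELOPMENT COLLAPSE for the RE-TYPED summit (T2: tame genericity, `RaysStayInClosure`,
# `IsFutureOriented`)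

At 2026-08-16T21:18Z the summit Statement was re-typed (semantic-vacuity audit T2). The crux's
single-development collapse `omegaAt_iff_generic_exists_settles_or_recurs` /
`finalStateConjecture_iff_generic_exists_settles` (`…OmegaLimitMultiKerrSingleDevelopment`, lead
gen 2, p112042) is stated over the pre-T2 settle clause `Settles` and the topology-free
`IsChristodoulouGeneric`. This file (line lead gen 7) proves the collapse for the T2 vocabulary
`SettlesT2 / OmegaAtT2 k` (`…OmegaLimitMultiKerrT2Defs`, p131533), which is what the restated crux
and every T2 route assembly consume. The one new piece of mathematics is the TRANSPORT of the two
new summit clauses along time-orientation preserving isometric diffeomorphisms of developments: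

* `hasExhaustiveCharts_transportDecomposition₂` — exhaustiveness with HONEST RADII (the re-typed
  `HasExhaustiveCharts`: `Rᵢ → ∞`, `Rᵢ(τ) ≥ max(r₊, 0) + 1`) is transported (same radii; re-proof of
  `OneLockedExplosion.hasExhaustiveCharts_transportDecomposition` for the new clause);
* `isFutureOriented_transportDecomposition` — FUTURE ORIENTATION of the charts is transported:
  motions are kept (orthochronous), and `d(ψ ∘ Ψ) V = dψ (dΨ V)` is future-directed causal when
  `dΨ V` is (chain rule + O'Neill's timecone lemma, `PreservesTimeOrientation.isFutureDirected_mfderiv`);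
* `raysStayInClosure_image_of_isometry` — `RaysStayInClosure 𝒟₁ O → RaysStayInClosure 𝒟₂ (ψ '' O)`:
  a normalised null ray of `𝒟₂` from `ι₂ p` lifts along `ψ` to one of `𝒟₁` from `p`
  (`exists_isNormalisedNullRayFrom_lift` over the identity sub-datum), ON THE SAME DOMAIN because
  `ψ⁻¹ ∘ γ` is a `g₁`-geodesic extending the maximal lift (isometries map geodesics to geodesics,
  `IsIsometricImmersion.isGeodesicOn_comp`), and `ψ (closure O) ⊆ closure (ψ O)`;
* `settlesT2_of_isIsometricTo` — the T2 settle disjunct is a property of the isometry class of a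
  development (registered structure stub of this file);
* `omegaAtT2_iff_tame_generic_exists_settlesT2_or_recurs` — for EVERY `k`,
  `OmegaAtT2 k ↔ ∀ X, IsTameChristodoulouGeneric (admissibleVacuumData X)
     (fun D ↦ ∃ 𝒟 maximal, SettlesT2 𝒟 ∨ Recurs k 𝒟) 1`
  (MGHD uniqueness up to isometry, `VacuumCauchyDevelopment.isIsometricTo_of_isMaximal'`, + transport
  of both disjuncts + monotonicity of tame genericity) — the ONE-STUB skeleton shape of the restated
  crux;
* `finalStateConjecture_iff_tame_generic_exists_settlesT2` — the re-typed summit is "tame-generically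
  SOME maximal development settles (T2)"; `omegaAtT2_of_tame_generic_exists_settlesT2`.

Everything is proved; Mathlib + landed tree modules only (tame genericity's monotonicity is a private
6-line copy of `InitialDataSet.IsTameChristodoulouGeneric.mono`). References: Choquet-Bruhat–Geroch,
Comm. Math. Phys. 14 (1969), Thm. 3; O'Neill, *Semi-Riemannian Geometry* (1983), Ch. 3 pp. 90–91,
Ch. 5 p. 145, Ch. 14 pp. 402–403; Dafermos–Luk, arXiv:1710.01722, §1.2.1 and Conjecture 1;
Christodoulou, CQG 16 (1999) A23, pp. A24, A26–A27.
-/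

-- every `Summit.FinalStateConjecture.FinalStateConjecture.…` name repeats the summit = sub-problem segment (D-0017 layout)
set_option linter.dupNamespace false

noncomputable section

open scoped Manifold ContDiff Topology
open Set Filter TopologicalSpace Function

namespace Summit.FinalStateConjecture.FinalStateConjecture.Theorems.ClusterCompleteness

open Literature.Geometry.Lorentzian
open Summit.FinalStateConjecture (HasCompleteNullInfinity exteriorOf RaysStayInClosure
  HasExhaustiveCharts IsFutureOriented certifiedLate certifiedSlab)
open Summit.FinalStateConjecture.FinalStateConjecture.Theorems.OneLockedExplosion
  (transportDecomposition charted_transportDecomposition certifiedLate_transportDecomposition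
    certifiedSlab_transportDecomposition mdifferentiable_diffeomorph isIsometry_symm
    preservesTimeOrientation_symm image_causalPast_eq truncDeviationCk_comp image_exteriorOf)
open Summit.FinalStateConjecture.FinalStateConjecture.Theorems.PhaseMixingCapture.WeakCosmicCensorshipMGHD
  (hasCompleteNullInfinity_iff_of_isIsometricTo exists_isNormalisedNullRayFrom_lift)

/-! ### Transport of the two T2 clauses along time-orientation preserving isometric diffeomorphisms -/

section SpacetimeTransport

variable {𝓢₁ 𝓢₂ : Spacetime.{0} 4}
  (ψ : Diffeomorph (𝓡 4) (𝓡 4) 𝓢₁.carrier 𝓢₂.carrier ∞)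
  (hiso : ∀ y, pullbackBilin (I := 𝓡 4) (I' := 𝓡 4) ψ 𝓢₂.metric.val y = 𝓢₁.metric.val y)
  (hτ : 𝓢₁.timeOrientation.PreservesTimeOrientation ψ 𝓢₂.timeOrientation)
  {O : Set 𝓢₁.carrier} {k : ℕ}

include hiso hτ in
/-- **Exhaustiveness of the charts is transported (re-typed clause, honest radii).** Same
near-zone radii `Rᵢ` (so `Rᵢ → ∞` and `Rᵢ(τ) ≥ max(r₊, 0) + 1` are literally kept), growing-slab
deviations unchanged (`truncDeviationCk_comp`), and the covering of `ψ(O)` by the causal past of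
the certified slabs from `ψ(J⁻(S)) = J⁻(ψ(S))`. Re-proof, for the 2026-08-16T21:18Z form of
`HasExhaustiveCharts`, of `OneLockedExplosion.hasExhaustiveCharts_transportDecomposition`.
[folklore] -/
theorem hasExhaustiveCharts_transportDecomposition₂ (d : FinalStateDecomposition 𝓢₁ O k)
    (h : HasExhaustiveCharts d) : HasExhaustiveCharts (transportDecomposition ψ hiso hτ d) := by
  obtain ⟨R, hR, hdev, hcov⟩ := h
  refine ⟨R, hR, fun i ↦ ?_, fun τ₁ hτ₁ ↦ ?_⟩
  · exact (hdev i).congr fun t ↦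
      (truncDeviationCk_comp ψ _ (d.isLateChart i).contMDiff hiso k (R i t) t).symm
  · have hinj : Function.Injective ψ := ψ.injective
    rw [certifiedLate_transportDecomposition, certifiedSlab_transportDecomposition,
      ← Set.image_sdiff hinj, ← image_causalPast_eq ψ hiso hτ]
    exact Set.image_mono (hcov τ₁ hτ₁)

include hiso hτ in
/-- Chain rule + timecone lemma for one chart: if `dΨ_x v` is future-directed in `𝓢₁`, then
`d(ψ ∘ Ψ)_x v = dψ (dΨ_x v)` is future-directed in `𝓢₂`. [folklore] -/
private theorem isFutureDirected_mfderiv_comp {U : Opens E4} {Ψ : U → 𝓢₁.carrier}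
    (hΨ : ContMDiff 𝓘(ℝ, E4) (𝓡 4) ∞ Ψ) {x : U} {v : E4}
    (hv : 𝓢₁.timeOrientation.IsFutureDirected (mfderiv 𝓘(ℝ, E4) (𝓡 4) Ψ x v)) :
    𝓢₂.timeOrientation.IsFutureDirected (mfderiv 𝓘(ℝ, E4) (𝓡 4) (ψ ∘ Ψ) x v) := by
  have hc : MDifferentiableAt 𝓘(ℝ, E4) (𝓡 4) Ψ x := (hΨ.mdifferentiable (by simp)) x
  rw [mfderiv_comp x (mdifferentiable_diffeomorph ψ _) hc]
  exact hτ.isFutureDirected_mfderiv hiso hv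

include hiso hτ in
/-- **Future orientation of the charts is transported.** The motions are kept, so they stay
orthochronous; the charts of the transported decomposition are `ψ ∘ Ψ`, so by the chain rule the
push-forwards of the backgrounds' future timelike fields are the `dψ`-images of the old ones, and
`dψ` maps future-directed causal vectors to future-directed causal vectors (`ψ` isometric and
time-orientation preserving, O'Neill 1983, Ch. 5, p. 145). [folklore] -/
theorem isFutureOriented_transportDecomposition (d : FinalStateDecomposition 𝓢₁ O k)
    (h : IsFutureOriented d) : IsFutureOriented (transportDecomposition ψ hiso hτ d) := by
  obtain ⟨h₁, h₂, h₃⟩ := h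
  refine ⟨h₁, fun i ρ ↦ (h₂ i ρ).mono fun τ hτ' x hx ↦ ?_, h₃.mono fun τ hτ' x hx ↦ ?_⟩
  · exact isFutureDirected_mfderiv_comp ψ hiso hτ (d.isLateChart i).contMDiff (hτ' x hx)
  · exact isFutureDirected_mfderiv_comp ψ hiso hτ d.isLateChart_flat.contMDiff (hτ' x hx)

end SpacetimeTransport

/-! ### Rays stay in the closure: transported along isometries of Cauchy developments -/

section Rays

variable {X : Type} [TopologicalSpace X] [ChartedSpace E3 X] [IsManifold (𝓡 3) ∞ X]
  [ConnectedSpace X] {D : InitialDataSet (𝓡 3) X}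

/-- **`RaysStayInClosure` is transported along isometries of developments.** Let
`ψ : 𝒟₁ ≃ 𝒟₂` be a time-orientation preserving isometric diffeomorphism with `ψ ∘ ι₁ = ι₂`. A
normalised null ray `γ : dom` of `𝒟₂` from `ι₂ p` restricts, on some `dom₁ ⊆ dom`, to `ψ ∘ γ₁`
with `γ₁ : dom₁` a normalised null ray of `𝒟₁` from `p` (`exists_isNormalisedNullRayFrom_lift`
over the identity sub-datum), and `dom₁ = dom` because `ψ⁻¹ ∘ γ` is a `g₁`-geodesic on `dom`
extending the MAXIMAL geodesic `γ₁` (isometries map geodesics to geodesics,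
`IsIsometricImmersion.isGeodesicOn_comp`); so `γ t = ψ (γ₁ t) ∈ ψ (closure O) ⊆ closure (ψ O)`.
O'Neill 1983, Ch. 3, pp. 90–91; Christodoulou, CQG 16 (1999) A23, pp. A26–A27. [folklore] -/
theorem raysStayInClosure_image_of_isometry {𝒟₁ 𝒟₂ : CauchyDevelopment D}
    (ψ : Diffeomorph (𝓡 4) (𝓡 4) 𝒟₁.carrier 𝒟₂.carrier ∞)
    (hiso : ∀ y, pullbackBilin (I := 𝓡 4) (I' := 𝓡 4) ψ 𝒟₂.metric.val y = 𝒟₁.metric.val y)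
    (hτ : 𝒟₁.timeOrientation.PreservesTimeOrientation ψ 𝒟₂.timeOrientation)
    (hι : ψ ∘ 𝒟₁.embed = 𝒟₂.embed) (O : Set 𝒟₁.carrier)
    (h : RaysStayInClosure 𝒟₁ O) : RaysStayInClosure 𝒟₂ (ψ '' O) := by
  intro inst₂ p γ dom hγ hdom t ht ht0
  haveI inst₁ : 𝒟₁.metric.HasLeviCivita := PseudoRiemannianMetric.hasLeviCivita _
  -- identity sub-datum
  have hΦ : ContMDiff (𝓡 3) (𝓡 3) (∞ + 1) (id : X → X) := contMDiff_id
  have hΦ' : ∀ u : X, Function.Injective (mfderiv (𝓡 3) (𝓡 3) (id : X → X) u) := fun u ↦ by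
    rw [mfderiv_id]
    exact fun v w hvw ↦ hvw
  -- the lift, with the sub-datum binder `DataEmbedding (D.comap id …)` generalised to a name `D'`
  have key : ∀ (D' : InitialDataSet (𝓡 3) X), D.comap id hΦ hΦ' = D' →
      ∀ (𝒮 : DataEmbedding D') (χ : 𝒮.carrier → 𝒟₂.carrier),
        ContMDiff (𝓡 4) (𝓡 4) ∞ χ →
        𝒮.metric.IsIsometricImmersion 𝒟₂.metric.toPseudoRiemannianMetric χ →
        𝒮.timeOrientation.PreservesTimeOrientation χ 𝒟₂.timeOrientation →
        χ ∘ 𝒮.embed = 𝒟₂.embed ∘ id →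
        ∀ [𝒮.metric.HasLeviCivita],
          ∃ (γ' : ℝ → 𝒮.carrier) (dom' : Set ℝ),
            𝒮.metric.IsNormalisedNullRayFrom 𝒮.timeOrientation 𝒮.embed 𝒮.normal p γ' dom' ∧
              dom' ⊆ dom ∧ ∀ s ∈ dom', χ (γ' s) = γ s := by
    intro D' e
    subst e
    intro 𝒮 χ hχ hisoχ hτχ hcomm _
    exact exists_isNormalisedNullRayFrom_lift 𝒟₂.toDataEmbedding 𝒮 hχ hisoχ hτχ hcomm hγ
  obtain ⟨γ₁, dom₁, hγ₁, hsub, hagree⟩ := key D (D.comap_eq_self_of_eq_id hΦ hΦ' rfl)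
    𝒟₁.toDataEmbedding ψ ψ.contMDiff ⟨ψ.contMDiff, hiso⟩ hτ (by rw [hι]; rfl)
  -- `ψ⁻¹ ∘ γ` is a `g₁`-geodesic on `dom` extending `γ₁`; maximality of `γ₁` gives `dom = dom₁`
  have hsymm : 𝒟₂.metric.toPseudoRiemannianMetric.IsIsometricImmersion
      𝒟₁.metric.toPseudoRiemannianMetric ψ.symm :=
    ⟨ψ.symm.contMDiff, isIsometry_symm (𝓢₁ := 𝒟₁.toSpacetime) (𝓢₂ := 𝒟₂.toSpacetime) ψ hiso⟩
  have hmax := hγ.isMaximalGeodesicOn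
  have hmax₁ := hγ₁.isMaximalGeodesicOn
  have hgeo : IsGeodesicOn 𝒟₁.metric.toPseudoRiemannianMetric.leviCivita (ψ.symm ∘ γ) dom :=
    (hsymm.isGeodesicOn_comp rfl hmax.1 hmax.isGeodesicOn).1
  have hdom : dom = dom₁ :=
    hmax₁.2.2.2 (ψ.symm ∘ γ) dom hmax.1 hmax.2.1 hsub hgeo fun s hs ↦ by
      simp only [Function.comp_apply, ← hagree s hs, Diffeomorph.symm_apply_apply]
  subst hdom
  -- conclude
  have hmem : γ₁ t ∈ closure O := h p γ₁ dom hγ₁ hdom t ht ht0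
  rw [← hagree t ht]
  exact image_closure_subset_closure_image ψ.continuous (Set.mem_image_of_mem _ hmem)

end Rays


/-! ### The T2 single-development collapse -/

section Genericity

variable {X : Type} [TopologicalSpace X] [ChartedSpace E3 X] [IsManifold (𝓡 3) ∞ X]

/-- Tame Christodoulou genericity is monotone under pointwise implication on the admissible class
(private local copy of `InitialDataSet.IsTameChristodoulouGeneric.mono`). [folklore] -/
private theorem isTameChristodoulouGeneric_mono₃ {𝓓 : Set (InitialDataSet (𝓡 3) X)}
    {P Q : InitialDataSet (𝓡 3) X → Prop} {m : ℕ}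
    (h : InitialDataSet.IsTameChristodoulouGeneric 𝓓 P m) (hPQ : ∀ d ∈ 𝓓, P d → Q d) :
    InitialDataSet.IsTameChristodoulouGeneric 𝓓 Q m := by
  intro d hd
  obtain ⟨e, F, hF, himm, h0, hinj, hadm, hexc⟩ := h d ⟨hd.1, fun hP ↦ hd.2 (hPQ d hd.1 hP)⟩
  exact ⟨e, F, hF, himm, h0, hinj, hadm,
    fun c hc hmem ↦ hexc c hc ⟨hmem.1, fun hP ↦ hmem.2 (hPQ _ hmem.1 hP)⟩⟩

end Genericity

/-- **The T2 settle disjunct is a property of the isometry class of a development.** If the vacuum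
Cauchy developments `𝒟₁`, `𝒟₂` of the same datum are isometric as developments and `𝒟₁` settles in
the T2 sense, so does `𝒟₂`: complete `𝓘⁺` is an invariant (`hasCompleteNullInfinity_iff_of_isIsometricTo`),
the `C²` sub-extremal decomposition of `O = exteriorOf 𝒟₁ charted` is transported to one of
`ψ(O) = exteriorOf 𝒟₂ ψ(charted)` with the same labels (`transportDecomposition`,
`charted_transportDecomposition`, `image_exteriorOf`), and the three summit clauses ride along:
`RaysStayInClosure` (`raysStayInClosure_image_of_isometry`), `HasExhaustiveCharts`
(`hasExhaustiveCharts_transportDecomposition₂`) and `IsFutureOriented`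
(`isFutureOriented_transportDecomposition`). [folklore] -/
theorem settlesT2_of_isIsometricTo : ∀ {X : Type} [TopologicalSpace X] [ChartedSpace E3 X]
    [IsManifold (𝓡 3) ∞ X] [ConnectedSpace X] {D : InitialDataSet (𝓡 3) X}
    {𝒟₁ 𝒟₂ : VacuumCauchyDevelopment D},
    𝒟₁.toCauchyDevelopment.IsIsometricTo 𝒟₂.toCauchyDevelopment → SettlesT2 𝒟₁ → SettlesT2 𝒟₂ := by
  intro X _ _ _ _ D 𝒟₁ 𝒟₂ h hS
  obtain ⟨hI, O, d, hsub, hO, hrays, hex, hfo⟩ := hS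
  refine ⟨(hasCompleteNullInfinity_iff_of_isIsometricTo _ _ h).1 hI, ?_⟩
  obtain ⟨ψ, hiso, hτ, hι⟩ := h
  refine ⟨ψ '' O, transportDecomposition (𝓢₁ := 𝒟₁.toSpacetime) (𝓢₂ := 𝒟₂.toSpacetime) ψ hiso hτ d,
    hsub, ?_, raysStayInClosure_image_of_isometry ψ hiso hτ hι O hrays,
    hasExhaustiveCharts_transportDecomposition₂ _ hiso hτ d hex,
    isFutureOriented_transportDecomposition _ hiso hτ d hfo⟩
  rw [charted_transportDecomposition, ← image_exteriorOf ψ hiso hτ hι, ← hO]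

/-- **The T2 crux at order `k` is its single-development form** (all orders): `OmegaAtT2 k` —
tame-generically "an MGHD exists and every MGHD not settling in the T2 sense recurs at order `k`" —
is equivalent to "tame-generically, SOME maximal vacuum Cauchy development settles (T2) or recurs at
order `k`": maximal developments of a datum are pairwise isometric as developments
(`VacuumCauchyDevelopment.isIsometricTo_of_isMaximal'`, Choquet-Bruhat–Geroch 1969, Thm. 3) and both
disjuncts are transported along such isometries (`settlesT2_of_isIsometricTo`,
`recurs_of_isIsometricTo`); tame genericity is monotone in the property. [folklore] -/
theorem omegaAtT2_iff_tame_generic_exists_settlesT2_or_recurs : ∀ k : ℕ,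
    OmegaAtT2 k ↔
      ∀ (X : Type) [TopologicalSpace X] [ChartedSpace E3 X] [IsManifold (𝓡 3) ∞ X] [T2Space X]
        [SecondCountableTopology X] [ConnectedSpace X],
        InitialDataSet.IsTameChristodoulouGeneric (admissibleVacuumData X)
          (fun D ↦ ∃ 𝒟 : VacuumCauchyDevelopment D, 𝒟.IsMaximal ∧ (SettlesT2 𝒟 ∨ Recurs k 𝒟)) 1 := by
  intro k
  refine ⟨fun h X _ _ _ _ _ _ ↦ ?_, fun h X _ _ _ _ _ _ ↦ ?_⟩
  · refine isTameChristodoulouGeneric_mono₃ (h X) fun D _ hP ↦ ?_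
    obtain ⟨⟨𝒟₀, h𝒟₀⟩, hall⟩ := hP
    by_cases hS : SettlesT2 𝒟₀
    · exact ⟨𝒟₀, h𝒟₀, Or.inl hS⟩
    · exact ⟨𝒟₀, h𝒟₀, Or.inr (hall 𝒟₀ h𝒟₀ hS)⟩
  · refine isTameChristodoulouGeneric_mono₃ (h X) fun D _ hP ↦ ?_
    obtain ⟨𝒟₀, h𝒟₀, hSR⟩ := hP
    refine ⟨⟨𝒟₀, h𝒟₀⟩, fun 𝒟 h𝒟 hnS ↦ ?_⟩
    have hiso := VacuumCauchyDevelopment.isIsometricTo_of_isMaximal' h𝒟₀ h𝒟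
    rcases hSR with hS | hR
    · exact absurd (settlesT2_of_isIsometricTo hiso hS) hnS
    · exact recurs_of_isIsometricTo hiso hR

/-- **The re-typed summit is its single-development form.** `FinalStateConjecture` —
tame-generically "an MGHD exists and every MGHD settles (T2)" (`finalStateConjecture_iff_tame`,
`Iff.rfl`) — is equivalent to "tame-generically, SOME maximal vacuum Cauchy development settles
(T2)", by MGHD uniqueness up to isometry of developments
(`VacuumCauchyDevelopment.isIsometricTo_of_isMaximal'`) and `settlesT2_of_isIsometricTo`. This is the
`∃`-form a stability theorem produces. [folklore] -/
theorem finalStateConjecture_iff_tame_generic_exists_settlesT2 :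
    FinalStateConjecture ↔
      ∀ (X : Type) [TopologicalSpace X] [ChartedSpace E3 X] [IsManifold (𝓡 3) ∞ X] [T2Space X]
        [SecondCountableTopology X] [ConnectedSpace X],
        InitialDataSet.IsTameChristodoulouGeneric (admissibleVacuumData X)
          (fun D ↦ ∃ 𝒟 : VacuumCauchyDevelopment D, 𝒟.IsMaximal ∧ SettlesT2 𝒟) 1 := by
  rw [finalStateConjecture_iff_tame]
  refine ⟨fun h X _ _ _ _ _ _ ↦ ?_, fun h X _ _ _ _ _ _ ↦ ?_⟩
  · refine isTameChristodoulouGeneric_mono₃ (h X) fun D _ hP ↦ ?_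
    obtain ⟨⟨𝒟₀, h𝒟₀⟩, hall⟩ := hP
    exact ⟨𝒟₀, h𝒟₀, hall 𝒟₀ h𝒟₀⟩
  · refine isTameChristodoulouGeneric_mono₃ (h X) fun D _ hP ↦ ?_
    obtain ⟨𝒟₀, h𝒟₀, hS⟩ := hP
    exact ⟨⟨𝒟₀, h𝒟₀⟩, fun 𝒟 h𝒟 ↦
      settlesT2_of_isIsometricTo (VacuumCauchyDevelopment.isIsometricTo_of_isMaximal' h𝒟₀ h𝒟) hS⟩

/-- **The T2 crux is CLOSED BY settling, single-development form**: if tame-generically some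
maximal development settles in the T2 sense (the single-development form of the re-typed summit),
then `OmegaAtT2 k` holds at every order. [folklore] -/
theorem omegaAtT2_of_tame_generic_exists_settlesT2 {k : ℕ}
    (h : ∀ (X : Type) [TopologicalSpace X] [ChartedSpace E3 X] [IsManifold (𝓡 3) ∞ X] [T2Space X]
        [SecondCountableTopology X] [ConnectedSpace X],
        InitialDataSet.IsTameChristodoulouGeneric (admissibleVacuumData X)
          (fun D ↦ ∃ 𝒟 : VacuumCauchyDevelopment D, 𝒟.IsMaximal ∧ SettlesT2 𝒟) 1) :
    OmegaAtT2 k :=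
  (omegaAtT2_iff_tame_generic_exists_settlesT2_or_recurs k).2 fun X _ _ _ _ _ _ ↦
    isTameChristodoulouGeneric_mono₃ (h X) fun _ _ ⟨𝒟₀, h𝒟₀, hS⟩ ↦ ⟨𝒟₀, h𝒟₀, Or.inl hS⟩


end Summit.FinalStateConjecture.FinalStateConjecture.Theorems.ClusterCompleteness

end
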